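import Mathlib
import HarnessLib

/-!
# Functional dependence of two functions with a vanishing planar Jacobian (local structure function)

Analysis/Calculus support file (everything proved, no named facts): the classical **functional dependence theorem**
in the form "two `Cⁿ` (or real-analytic, `n = ω`) functions `f, g` whose Jacobian in two distinguished directions
`u, k` vanishes identically near a point `a`, with `Dg(a)u ≠ 0`, satisfy `f = F(g, ·)` near `a` for a `Cⁿ` STRUCTURE
FUNCTION `F` that does not depend on the `u`- and `k`-coordinates" — the case `n = 2`, `k = 1` WITH PARAMETERS (the
coordinates transverse to the `(u,k)`-plane) of Zorich, *Mathematical Analysis I* (2nd ed., Springer 2015), §8.6.3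
Proposition 1 [cite: ZorichAnalysisI2015, §8.6.3 Prop. 1] (see also Rudin, *Principles*, Thm. 9.32, the rank theorem),
proved from Mathlib's `Cⁿ` inverse function theorem
(`ContDiffAt.toOpenPartialHomeomorph`, complete spaces, `RCLike` field `ℝ`, every `n ≠ 0` including `n = ω`).

* `exists_rankOne_equiv` — Sherman–Morrison: for a continuous linear functional `φ` and a vector `u` with `1 + φ u ≠ 0`
  the rank-one perturbation `h ↦ h + φ(h) u` of the identity is a continuous linear equivalence (the derivative of the
  straightening map `x ↦ x + (g x − ℓ x) u` below).
* `apply_add_smul_eq_of_fderiv_eq_zero` — constancy along a segment `[y, y + s k]` of a function differentiable there with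
  vanishing derivative in the direction `k` (one-variable mean value theorem).
* `exists_comp_of_bracket_eq_zero` — **the structure function, abstract form.**  `E` a complete real normed space,
  `u k : E` with "coordinate" functionals `ℓ m : E →L[ℝ] ℝ` (`ℓ u = 1`, `ℓ k = 0`, `m u = 0`, `m k = 1`), `f g : E → ℝ` of
  class `Cⁿ` at `a` (`n ≠ 0`), `Dg(a)u ≠ 0`, and the BRACKET `Df(x)u · Dg(x)k = Df(x)k · Dg(x)u` for all `x` near `a`.
  Then there is `F : ℝ × E → ℝ`, `Cⁿ` at `(g a, a)`, with `f x = F (g x, x)` for all `x` near `a` and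
  `F (q, x + s u) = F (q, x) = F (q, x + s k)` identically: `f` is a function of `g` and of the coordinates transverse
  to the `(u,k)`-plane.  (Straighten `g` to the `u`-coordinate by the local `Cⁿ` diffeomorphism
  `Θ x = x + (g x − ℓ x) u`; the bracket says exactly that `f ∘ Θ⁻¹` has zero derivative along `k`; integrate along
  short `k`-segments.)
* `eq_add_smul_of_horizontal` — coordinates on `ℝ³`: `y = a + (y₂ − a₂)e₂ + (y_{b₀} − a_{b₀})e_{b₀} + (y_{b₁} − a_{b₁})e_{b₁}`
  for the two horizontal indices `{b₀, b₁} = {0, 1}`.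
* `exists_comp_slice` — **`ℝ³` form**: `f g : ℝ³ → ℝ` of class `Cⁿ` at `a` with vanishing horizontal Jacobian
  `∂_{b₀}f ∂_{b₁}g = ∂_{b₁}f ∂_{b₀}g` near `a` and `∂_{b₀}g(a) ≠ 0` ⇒ `f y = G (g y, y₂)` near `a`, `G : ℝ × ℝ → ℝ` of class
  `Cⁿ` at `(g a, a₂)`.
* `exists_comp_spaceTime` — **space–time form** on `ℝ × ℝ³` (horizontal directions `(0, e_{b₀})`, `(0, e_{b₁})`):
  `f x = G (x.1, g x, x.2 2)` near `a`, `G : ℝ × ℝ × ℝ → ℝ` of class `Cⁿ` at `(a.1, g a, a.2 2)` — the shape in which the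
  structure function `v₃ = F(t, W, x₃)` of a poloidal flow (frozen constraint `{v₃, W}_h = 0`) is obtained.

WHAT THIS IS NOT: not the general rank theorem (one dependent direction `k` and one pivot `u` only — the planar case used by
the poloidal Navier–Stokes normal form); no statement about maximal domains of `F`.
-/

noncomputable section

namespace Literature.Analysis.Calculus

open Set Function Filter Metric
open _root_.Topology

section Abstract

variable {E : Type*} [NormedAddCommGroup E] [NormedSpace ℝ E]

/-- **Sherman–Morrison, rank one.**  For a continuous linear functional `φ` on a real normed space `E` and `u : E`
with `1 + φ u ≠ 0`, the map `h ↦ h + φ(h) • u` is a continuous linear automorphism of `E` (its inverse is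
`h ↦ h − (1 + φ u)⁻¹ φ(h) • u`).  Private helper (the derivative of the straightening map). [folklore] -/
private theorem exists_rankOne_equiv (φ : E →L[ℝ] ℝ) (u : E) (h : 1 + φ u ≠ 0) :
    ∃ A : E ≃L[ℝ] E, ∀ x, A x = x + φ x • u := by
  refine ⟨ContinuousLinearEquiv.equivOfInverse
    (ContinuousLinearMap.id ℝ E + φ.smulRight u)
    (ContinuousLinearMap.id ℝ E - ((1 + φ u)⁻¹ • φ).smulRight u) ?_ ?_, fun x => rfl⟩
  · intro x
    simp only [add_apply, ContinuousLinearMap.id_apply, ContinuousLinearMap.smulRight_apply, sub_apply,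
      smul_apply, map_add, map_smul, smul_eq_mul]
    match_scalars <;> field_simp
    ring
  · intro x
    simp only [add_apply, ContinuousLinearMap.id_apply, ContinuousLinearMap.smulRight_apply, sub_apply,
      smul_apply, map_sub, map_smul, smul_eq_mul]
    match_scalars <;> field_simp
    ring

/-- **Constancy along a segment from a vanishing directional derivative.**  If `F : E → ℝ` is differentiable at every
point `y + τ • k`, `τ` between `0` and `s`, with `DF(y + τ • k) k = 0`, then `F (y + s • k) = F y` (mean value theorem
for `τ ↦ F (y + τ • k)`).  Private helper. [folklore] -/
private theorem apply_add_smul_eq_of_fderiv_eq_zero {F : E → ℝ} {y k : E} {s : ℝ}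
    (h : ∀ τ ∈ uIcc (0 : ℝ) s, DifferentiableAt ℝ F (y + τ • k) ∧ fderiv ℝ F (y + τ • k) k = 0) :
    F (y + s • k) = F y := by
  set φ : ℝ → ℝ := fun τ => F (y + τ • k) with hφ
  have hder : ∀ τ ∈ uIcc (0 : ℝ) s, HasDerivAt φ 0 τ := by
    intro τ hτ
    obtain ⟨hd, hz⟩ := h τ hτ
    have hγ : HasDerivAt (fun τ : ℝ => y + τ • k) k τ := by
      simpa using ((hasDerivAt_id τ).smul_const k).const_add y
    have h := HasFDerivAt.comp_hasDerivAt τ hd.hasFDerivAt hγ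
    rw [hz] at h
    exact h
  have hcont : ContinuousOn φ (Icc (min 0 s) (max 0 s)) := fun τ hτ =>
    (hder τ hτ).continuousAt.continuousWithinAt
  have hconst := constant_of_has_deriv_right_zero hcont
    (fun τ hτ => (hder τ (Ico_subset_Icc_self hτ)).hasDerivWithinAt)
  have h0 : φ 0 = φ (min 0 s) := hconst 0 ⟨min_le_left _ _, le_max_left _ _⟩
  have hs : φ s = φ (min 0 s) := hconst s ⟨min_le_right _ _, le_max_right _ _⟩
  have : φ s = φ 0 := by rw [hs, h0]
  simpa [hφ] using this

variable [CompleteSpace E]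

/-- **Functional dependence from a vanishing bracket (local structure function), abstract form.**  Let `E` be a
complete real normed space, `u k : E` two directions with continuous linear "coordinates" `ℓ m : E →L[ℝ] ℝ`,
`ℓ u = 1`, `ℓ k = 0`, `m u = 0`, `m k = 1`.  Let `f g : E → ℝ` be `Cⁿ` at `a` (`n ≠ 0`; `n = ω` allowed), with
`Dg(a)u ≠ 0` and with vanishing Jacobian in the `(u,k)`-plane near `a`: `Df(x)u · Dg(x)k = Df(x)k · Dg(x)u` for all
`x` in a neighbourhood of `a`.  Then there is a STRUCTURE FUNCTION `F : ℝ × E → ℝ`, of class `Cⁿ` at `(g a, a)`, with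
`f x = F (g x, x)` for all `x` near `a`, and which does not depend on the `u`- and `k`-coordinates of its second
argument: `F (q, x + s • u) = F (q, x)` and `F (q, x + s • k) = F (q, x)` for all `q, x, s`.  This is Zorich's
functional dependence proposition (constant rank `1` of the pair `(g, f)` in the `(u,k)`-plane) in the case of two
functions, with the transverse coordinates carried as parameters; proof: `Cⁿ` inverse function theorem for
`Θ x = x + (g x − ℓ x) • u`, then the mean value theorem along `k`. [cite: ZorichAnalysisI2015, §8.6.3 Prop. 1] -/
theorem exists_comp_of_bracket_eq_zero {n : WithTop ℕ∞} (hn : n ≠ 0)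
    {f g : E → ℝ} {a u k : E} {ℓ m : E →L[ℝ] ℝ}
    (hℓu : ℓ u = 1) (hℓk : ℓ k = 0) (hmu : m u = 0) (hmk : m k = 1)
    (hf : ContDiffAt ℝ n f a) (hg : ContDiffAt ℝ n g a) (hu : fderiv ℝ g a u ≠ 0)
    (hbr : ∀ᶠ x in 𝓝 a, fderiv ℝ f x u * fderiv ℝ g x k = fderiv ℝ f x k * fderiv ℝ g x u) :
    ∃ F : ℝ × E → ℝ, ContDiffAt ℝ n F (g a, a) ∧ (∀ᶠ x in 𝓝 a, f x = F (g x, x)) ∧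
      (∀ q x (s : ℝ), F (q, x + s • u) = F (q, x)) ∧ (∀ q x (s : ℝ), F (q, x + s • k) = F (q, x)) := by
  have hn1 : (1 : WithTop ℕ∞) ≤ n := ENat.one_le_iff_ne_zero_withTop.mpr hn
  -- the straightening map `Θ x = x + (g x - ℓ x) • u` and its (invertible) derivative at `a`
  set φ : E →L[ℝ] ℝ := fderiv ℝ g a - ℓ with hφ
  have hφu : 1 + φ u = fderiv ℝ g a u := by
    simp only [hφ, sub_apply, hℓu]; ring
  have h1φ : 1 + φ u ≠ 0 := by rw [hφu]; exact hu
  obtain ⟨A, hA⟩ := exists_rankOne_equiv φ u h1φ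
  set Θ : E → E := fun x => x + (g x - ℓ x) • u with hΘ
  have hΘd : HasFDerivAt Θ (A : E →L[ℝ] E) a := by
    have h1 : HasFDerivAt (fun x => g x - ℓ x) φ a :=
      (hg.differentiableAt hn).hasFDerivAt.sub ℓ.hasFDerivAt
    have h2 := (hasFDerivAt_id a).add (h1.smul_const u)
    refine h2.congr_fderiv ?_
    ext h
    simp [hA]
  have hΘc : ContDiffAt ℝ n Θ a :=
    contDiffAt_id.add ((hg.sub ℓ.contDiff.contDiffAt).smul contDiffAt_const)
  have hstrict : HasStrictFDerivAt Θ (A : E →L[ℝ] E) a := hΘc.hasStrictFDerivAt' hΘd hn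
  -- the local inverse `Ψ`
  set Ψ : E → E := hΘc.localInverse hΘd hn with hΨ
  have hΨΘ : ∀ᶠ x in 𝓝 a, Ψ (Θ x) = x := hstrict.eventually_left_inverse
  have hΘΨ : ∀ᶠ y in 𝓝 (Θ a), Θ (Ψ y) = y := hstrict.eventually_right_inverse
  have hΨa : Ψ (Θ a) = a := hstrict.localInverse_apply_image
  have hΨt : Tendsto Ψ (𝓝 (Θ a)) (𝓝 a) := hstrict.localInverse_tendsto
  have hΨc : ContDiffAt ℝ n Ψ (Θ a) := hΘc.to_localInverse hΘd hn
  -- `Ft := f ∘ Ψ`, so that `f = Ft ∘ Θ` near `a`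
  set Ft : E → ℝ := f ∘ Ψ with hFt
  have hFtc : ContDiffAt ℝ n Ft (Θ a) := by
    have hfa : ContDiffAt ℝ n f (Ψ (Θ a)) := by rw [hΨa]; exact hf
    exact hfa.comp (Θ a) hΨc
  have hfeq : ∀ᶠ x in 𝓝 a, f x = Ft (Θ x) :=
    hΨΘ.mono fun x hx => by simp only [hFt, comp_apply, hx]
  -- `C¹` consequences near `a` and near `Θ a`
  have hf1 : ∀ᶠ x in 𝓝 a, ContDiffAt ℝ 1 f x := (hf.of_le hn1).eventually (by simp)
  have hg1 : ∀ᶠ x in 𝓝 a, ContDiffAt ℝ 1 g x := (hg.of_le hn1).eventually (by simp)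
  have hFt1 : ∀ᶠ y in 𝓝 (Θ a), ContDiffAt ℝ 1 Ft y := (hFtc.of_le hn1).eventually (by simp)
  have hgu : ∀ᶠ x in 𝓝 a, fderiv ℝ g x u ≠ 0 := by
    have h0 : (0 : WithTop ℕ∞) + 1 ≤ n := by simpa using hn1
    have hc : ContinuousAt (fun x => fderiv ℝ g x u) a :=
      ((hg.fderiv_right h0).continuousAt).clm_apply continuousAt_const
    exact hc.eventually_ne hu
  have hΘt : Tendsto Θ (𝓝 a) (𝓝 (Θ a)) := hΘc.continuousAt
  -- KEY: the derivative of `Ft` along `k` vanishes at `Θ x` for `x` near `a`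
  have hkey : ∀ᶠ x in 𝓝 a, fderiv ℝ Ft (Θ x) k = 0 := by
    filter_upwards [hf1, hg1, hgu, hbr, hfeq.eventually_nhds, hΘt.eventually hFt1]
      with x hfx hgx hgux hbrx hfeqx hFtx
    have hΘx : HasFDerivAt Θ (ContinuousLinearMap.id ℝ E + (fderiv ℝ g x - ℓ).smulRight u) x := by
      have h1 : HasFDerivAt (fun x => g x - ℓ x) (fderiv ℝ g x - ℓ) x :=
        (hgx.differentiableAt one_ne_zero).hasFDerivAt.sub ℓ.hasFDerivAt
      exact (hasFDerivAt_id x).add (h1.smul_const u)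
    have hcomp : HasFDerivAt (fun x => Ft (Θ x))
        ((fderiv ℝ Ft (Θ x)).comp (ContinuousLinearMap.id ℝ E + (fderiv ℝ g x - ℓ).smulRight u)) x :=
      (hFtx.differentiableAt one_ne_zero).hasFDerivAt.comp x hΘx
    have hfd : HasFDerivAt f
        ((fderiv ℝ Ft (Θ x)).comp (ContinuousLinearMap.id ℝ E + (fderiv ℝ g x - ℓ).smulRight u)) x :=
      hcomp.congr_of_eventuallyEq hfeqx
    have e1 : u + (fderiv ℝ g x u - ℓ u) • u = (fderiv ℝ g x u) • u := by
      rw [hℓu, sub_smul, one_smul]; abel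
    have hDu : fderiv ℝ f x u = fderiv ℝ g x u * fderiv ℝ Ft (Θ x) u := by
      rw [hfd.fderiv, ContinuousLinearMap.comp_apply, add_apply,
        ContinuousLinearMap.id_apply, ContinuousLinearMap.smulRight_apply, sub_apply, e1,
        map_smul, smul_eq_mul]
    have hDk : fderiv ℝ f x k = fderiv ℝ Ft (Θ x) k + fderiv ℝ g x k * fderiv ℝ Ft (Θ x) u := by
      rw [hfd.fderiv, ContinuousLinearMap.comp_apply, add_apply,
        ContinuousLinearMap.id_apply, ContinuousLinearMap.smulRight_apply, sub_apply, hℓk,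
        sub_zero, map_add, map_smul, smul_eq_mul]
    rw [hDu, hDk] at hbrx
    have hz : fderiv ℝ Ft (Θ x) k * fderiv ℝ g x u = 0 := by linear_combination (-1 : ℝ) * hbrx
    exact (mul_eq_zero.1 hz).resolve_right hgux
  -- transport to a neighbourhood of `Θ a`
  have hkey' : ∀ᶠ y in 𝓝 (Θ a), fderiv ℝ Ft y k = 0 := by
    filter_upwards [hΨt.eventually hkey, hΘΨ] with y hy hyy
    rwa [hyy] at hy
  have hFtd : ∀ᶠ y in 𝓝 (Θ a), DifferentiableAt ℝ Ft y :=
    hFt1.mono fun y hy => hy.differentiableAt one_ne_zero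
  obtain ⟨r, hr, hball⟩ := Metric.eventually_nhds_iff_ball.1 (hFtd.and hkey')
  -- `Ft` is constant along short `k`-segments issued from `Θ x`, `x` near `a`
  have hnear1 : ∀ᶠ x in 𝓝 a, dist (Θ x) (Θ a) < r / 2 :=
    hΘt.eventually (Metric.ball_mem_nhds _ (half_pos hr))
  have hnear2 : ∀ᶠ x in 𝓝 a, |m (x - a)| * ‖k‖ < r / 2 := by
    have hc : Tendsto (fun x => |m (x - a)| * ‖k‖) (𝓝 a) (𝓝 (|m (a - a)| * ‖k‖)) :=
      ((continuous_abs.comp (m.continuous.comp (continuous_id.sub continuous_const))).mul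
        continuous_const).continuousAt
    have h0 : |m (a - a)| * ‖k‖ < r / 2 := by simp [half_pos hr]
    exact hc.eventually_lt_const h0
  have hseg : ∀ᶠ x in 𝓝 a, Ft (Θ x + (-(m (x - a))) • k) = Ft (Θ x) := by
    filter_upwards [hnear1, hnear2] with x h1 h2
    apply apply_add_smul_eq_of_fderiv_eq_zero
    intro τ hτ
    apply hball
    rw [mem_ball, dist_eq_norm]
    have hτ' : |τ| ≤ |m (x - a)| := by
      have h := Set.abs_sub_left_of_mem_uIcc hτ
      simp only [sub_zero, abs_neg] at h
      exact h
    have hτk : |τ| * ‖k‖ ≤ |m (x - a)| * ‖k‖ := mul_le_mul_of_nonneg_right hτ' (norm_nonneg k)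
    calc ‖Θ x + τ • k - Θ a‖ = ‖(Θ x - Θ a) + τ • k‖ := by abel_nf
      _ ≤ ‖Θ x - Θ a‖ + ‖τ • k‖ := norm_add_le _ _
      _ = dist (Θ x) (Θ a) + |τ| * ‖k‖ := by rw [dist_eq_norm, norm_smul, Real.norm_eq_abs]
      _ < r / 2 + r / 2 := by linarith
      _ = r := by ring
  -- the structure function
  set L : ℝ × E → E := fun p => p.2 - (m p.2 - m a) • k + (p.1 - ℓ p.2) • u with hL
  have hLc : ContDiff ℝ n L := by
    simp only [hL]
    fun_prop
  have hLa : L (g a, a) = Θ a := by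
    simp only [hL, hΘ, sub_self, zero_smul, sub_zero]
  refine ⟨fun p => Ft (L p), ?_, ?_, ?_, ?_⟩
  · have h1 : ContDiffAt ℝ n Ft (L (g a, a)) := by rw [hLa]; exact hFtc
    exact h1.comp (g a, a) hLc.contDiffAt
  · filter_upwards [hfeq, hseg] with x hx hs
    have e : L (g x, x) = Θ x + (-(m (x - a))) • k := by
      simp only [hL, hΘ, map_sub]
      module
    show f x = Ft (L (g x, x))
    rw [e, hs, hx]
  · intro q x s
    show Ft (L (q, x + s • u)) = Ft (L (q, x))
    congr 1
    simp only [hL, map_add, map_smul, hmu, hℓu, smul_eq_mul, mul_zero, mul_one, add_zero]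
    module
  · intro q x s
    show Ft (L (q, x + s • k)) = Ft (L (q, x))
    congr 1
    simp only [hL, map_add, map_smul, hmk, hℓk, smul_eq_mul, mul_zero, mul_one, add_zero]
    module

end Abstract

/-! ### Coordinates: `ℝ³` and space–time `ℝ × ℝ³` -/

section Coordinates

/-- **Planar coordinates on `ℝ³`.**  For the two horizontal indices `{b₀, b₁} = {0, 1}`:
`y = a + (y₂ − a₂) e₂ + (y_{b₀} − a_{b₀}) e_{b₀} + (y_{b₁} − a_{b₁}) e_{b₁}`.  Private coordinate plumbing. [folklore] -/
private theorem eq_add_smul_of_horizontal {b₀ b₁ : Fin 3} (hb₀ : b₀ ≠ 2) (hb₁ : b₁ ≠ 2) (hb : b₀ ≠ b₁)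
    (a y : EuclideanSpace ℝ (Fin 3)) :
    y = a + (y 2 - a 2) • EuclideanSpace.single 2 1 + (y b₀ - a b₀) • EuclideanSpace.single b₀ 1 +
      (y b₁ - a b₁) • EuclideanSpace.single b₁ 1 := by
  have hcases : (b₀ = 0 ∧ b₁ = 1) ∨ (b₀ = 1 ∧ b₁ = 0) := by
    revert hb₀ hb₁ hb
    fin_cases b₀ <;> fin_cases b₁ <;> simp
  ext i
  rcases hcases with ⟨rfl, rfl⟩ | ⟨rfl, rfl⟩ <;> fin_cases i <;> simp

/-- **Functional dependence on `ℝ³` (structure function of a slice).**  Let `f g : ℝ³ → ℝ` be `Cⁿ` at `a` (`n ≠ 0`),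
`{b₀, b₁} = {0, 1}` the horizontal indices, `∂_{b₀} g(a) ≠ 0`, and suppose the horizontal Jacobian vanishes near `a`:
`∂_{b₀}f ∂_{b₁}g = ∂_{b₁}f ∂_{b₀}g`.  Then `f y = G (g y, y₂)` for all `y` near `a`, for some `G : ℝ × ℝ → ℝ` of class
`Cⁿ` at `(g a, a₂)`: on each horizontal plane `f` is a function of `g` (Zorich's Proposition 1, two functions of the
horizontal variables, the height `y₂` as a parameter). [cite: ZorichAnalysisI2015, §8.6.3 Prop. 1] -/
theorem exists_comp_slice {n : WithTop ℕ∞} (hn : n ≠ 0) {f g : EuclideanSpace ℝ (Fin 3) → ℝ}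
    {a : EuclideanSpace ℝ (Fin 3)} {b₀ b₁ : Fin 3} (hb₀ : b₀ ≠ 2) (hb₁ : b₁ ≠ 2) (hb : b₀ ≠ b₁)
    (hf : ContDiffAt ℝ n f a) (hg : ContDiffAt ℝ n g a)
    (hpin : fderiv ℝ g a (EuclideanSpace.single b₀ 1) ≠ 0)
    (hbr : ∀ᶠ y in 𝓝 a,
      fderiv ℝ f y (EuclideanSpace.single b₀ 1) * fderiv ℝ g y (EuclideanSpace.single b₁ 1) =
        fderiv ℝ f y (EuclideanSpace.single b₁ 1) * fderiv ℝ g y (EuclideanSpace.single b₀ 1)) :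
    ∃ G : ℝ × ℝ → ℝ, ContDiffAt ℝ n G (g a, a 2) ∧ ∀ᶠ y in 𝓝 a, f y = G (g y, y 2) := by
  obtain ⟨F, hFc, hFeq, hFu, hFk⟩ := exists_comp_of_bracket_eq_zero hn
    (u := EuclideanSpace.single b₀ (1 : ℝ)) (k := EuclideanSpace.single b₁ (1 : ℝ))
    (ℓ := EuclideanSpace.proj b₀) (m := EuclideanSpace.proj b₁)
    (by simp) (by simp [hb.symm]) (by simp [hb]) (by simp) hf hg hpin hbr
  set e₂ : EuclideanSpace ℝ (Fin 3) := EuclideanSpace.single 2 1 with he₂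
  refine ⟨fun p => F (p.1, a + (p.2 - a 2) • e₂), ?_, ?_⟩
  · have hA : ContDiff ℝ n (fun p : ℝ × ℝ => (p.1, a + (p.2 - a 2) • e₂)) := by fun_prop
    have hAa : (fun p : ℝ × ℝ => (p.1, a + (p.2 - a 2) • e₂)) (g a, a 2) = (g a, a) := by simp
    have h1 : ContDiffAt ℝ n F ((fun p : ℝ × ℝ => (p.1, a + (p.2 - a 2) • e₂)) (g a, a 2)) := by
      rw [hAa]; exact hFc
    exact h1.comp (g a, a 2) hA.contDiffAt
  · filter_upwards [hFeq] with y hy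
    have e := eq_add_smul_of_horizontal hb₀ hb₁ hb a y
    have h1 : F (g y, y) = F (g y, a + (y 2 - a 2) • e₂ + (y b₀ - a b₀) • EuclideanSpace.single b₀ 1 +
        (y b₁ - a b₁) • EuclideanSpace.single b₁ 1) := congrArg (fun z => F (g y, z)) e
    rw [hy, h1, hFk, hFu]

/-- **Functional dependence on space–time `ℝ × ℝ³` (time-dependent structure function).**  Let
`f g : ℝ × ℝ³ → ℝ` be `Cⁿ` at `a` (`n ≠ 0`), `{b₀, b₁} = {0, 1}`, `D g(a)(0, e_{b₀}) ≠ 0`, and suppose the horizontal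
Jacobian vanishes near `a`: `Df(x)(0,e_{b₀}) · Dg(x)(0,e_{b₁}) = Df(x)(0,e_{b₁}) · Dg(x)(0,e_{b₀})`.  Then
`f x = G (x.1, g x, x.2 2)` for all `x` near `a`, for some `G : ℝ × ℝ × ℝ → ℝ` of class `Cⁿ` at `(a.1, g a, a.2 2)`:
at each time and on each horizontal plane, `f` is a function of `g` (Zorich's Proposition 1 with the parameters
`(t, y₂)`). [cite: ZorichAnalysisI2015, §8.6.3 Prop. 1] -/
theorem exists_comp_spaceTime {n : WithTop ℕ∞} (hn : n ≠ 0) {f g : ℝ × EuclideanSpace ℝ (Fin 3) → ℝ}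
    {a : ℝ × EuclideanSpace ℝ (Fin 3)} {b₀ b₁ : Fin 3} (hb₀ : b₀ ≠ 2) (hb₁ : b₁ ≠ 2) (hb : b₀ ≠ b₁)
    (hf : ContDiffAt ℝ n f a) (hg : ContDiffAt ℝ n g a)
    (hpin : fderiv ℝ g a ((0 : ℝ), EuclideanSpace.single b₀ (1 : ℝ)) ≠ 0)
    (hbr : ∀ᶠ x in 𝓝 a,
      fderiv ℝ f x ((0 : ℝ), EuclideanSpace.single b₀ (1 : ℝ)) * fderiv ℝ g x ((0 : ℝ), EuclideanSpace.single b₁ (1 : ℝ)) =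
        fderiv ℝ f x ((0 : ℝ), EuclideanSpace.single b₁ (1 : ℝ)) *
          fderiv ℝ g x ((0 : ℝ), EuclideanSpace.single b₀ (1 : ℝ))) :
    ∃ G : ℝ × ℝ × ℝ → ℝ, ContDiffAt ℝ n G (a.1, g a, a.2 2) ∧ ∀ᶠ x in 𝓝 a, f x = G (x.1, g x, x.2 2) := by
  obtain ⟨F, hFc, hFeq, hFu, hFk⟩ := exists_comp_of_bracket_eq_zero hn
    (u := ((0 : ℝ), EuclideanSpace.single b₀ (1 : ℝ))) (k := ((0 : ℝ), EuclideanSpace.single b₁ (1 : ℝ)))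
    (ℓ := (EuclideanSpace.proj b₀).comp (ContinuousLinearMap.snd ℝ ℝ (EuclideanSpace ℝ (Fin 3))))
    (m := (EuclideanSpace.proj b₁).comp (ContinuousLinearMap.snd ℝ ℝ (EuclideanSpace ℝ (Fin 3))))
    (by simp) (by simp [hb.symm]) (by simp [hb]) (by simp) hf hg hpin hbr
  set e₂ : EuclideanSpace ℝ (Fin 3) := EuclideanSpace.single 2 1 with he₂
  refine ⟨fun p => F (p.2.1, (p.1, a.2 + (p.2.2 - a.2 2) • e₂)), ?_, ?_⟩
  · have hA : ContDiff ℝ n (fun p : ℝ × ℝ × ℝ => (p.2.1, (p.1, a.2 + (p.2.2 - a.2 2) • e₂))) := by fun_prop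
    have hAa : (fun p : ℝ × ℝ × ℝ => (p.2.1, (p.1, a.2 + (p.2.2 - a.2 2) • e₂))) (a.1, g a, a.2 2) = (g a, a) := by
      simp
    have h1 : ContDiffAt ℝ n F
        ((fun p : ℝ × ℝ × ℝ => (p.2.1, (p.1, a.2 + (p.2.2 - a.2 2) • e₂))) (a.1, g a, a.2 2)) := by
      rw [hAa]; exact hFc
    exact h1.comp (a.1, g a, a.2 2) hA.contDiffAt
  · filter_upwards [hFeq] with x hx
    have e := eq_add_smul_of_horizontal hb₀ hb₁ hb a.2 x.2
    have e' : x = (x.1, a.2 + (x.2 2 - a.2 2) • e₂) +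
        (x.2 b₀ - a.2 b₀) • ((0 : ℝ), EuclideanSpace.single b₀ (1 : ℝ)) +
        (x.2 b₁ - a.2 b₁) • ((0 : ℝ), EuclideanSpace.single b₁ (1 : ℝ)) := by
      ext1
      · simp
      · simpa using e
    have h1 : F (g x, x) = F (g x, (x.1, a.2 + (x.2 2 - a.2 2) • e₂) +
        (x.2 b₀ - a.2 b₀) • ((0 : ℝ), EuclideanSpace.single b₀ (1 : ℝ)) +
        (x.2 b₁ - a.2 b₁) • ((0 : ℝ), EuclideanSpace.single b₁ (1 : ℝ))) := congrArg (fun z => F (g x, z)) e'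
    rw [hx, h1, hFk, hFu]

end Coordinates

end Literature.Analysis.Calculus

end
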